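import Literature.NumberTheory.GaloisRepresentations.NeukirchLocalAxiomsNF
import Literature.NumberTheory.GaloisRepresentations.AbsIntegersValuationSubringsMaximalIdeals
import Literature.NumberTheory.GaloisRepresentations.IntegralGaloisActionProofs
import Literature.AnabelianGeometry.AbsoluteAnabelian.NumberFieldValuationProSet
import Literature.AnabelianGeometry.AbsoluteAnabelian.NFGaloisGroupsProofs
import HarnessLib

/-!
# Structural binders of the abstract Neukirch lemma at `Γ_K`, `K` a number field

Topic `NumberTheory/GaloisRepresentations`; namespace
`Literature.NumberTheory.GaloisRepresentations.ExplicitMuCocycles`.  Proof file: theorems only (no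
definition, no instance, no named fact).  Classical algebraic number theory — the STRUCTURAL
hypotheses of abc-iut-w5-d055's `NeukirchAbstract.exists_prime_smul_eq_of_localType`
([NSW] Prop. (12.1.9); abc-iut GAP-LEDGER row G-L4d2g4-1, campaign L; assembly plan
`HOME/staging/w5/w5-d055/g7/ASSEMBLY-PLAN.md`) instantiated at `Γ := absoluteGaloisGroup K`,
`P :=` the nontrivial valuation subrings of `K̄` (`NumberFieldValuationProSet.NonArch K`), `R := ZMod ℓ`, `V₀ := Stab_Γ(ζ)` for a primitive `ℓ`-th root `ζ ∈ K̄`: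

* `isClosed_stabilizer_valuationSubring` — (hst) decomposition groups `Stab_Γ(A)` are closed
  (`isClosed_decompositionGroupNF`, abc-iut-L4-d2);
* `exists_smul_eq_of_under_absIntegersCentre_eq` — two nontrivial valuation subrings whose centres on
  `\bar ℤ_K` lie over the same prime of `𝓞 K` are `Γ`-conjugate (Neukirch *ANT* I (9.1) for the
  profinite `Γ` on `\bar ℤ_K`, Mathlib `Algebra.IsInvariant.exists_smul_of_under_eq_of_profinite`, and
  the centre dictionary `absIntegersCentre_smul` / `eq_absIntegersValuationSubring_of_absIntegersCentre_eq`);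
  hence `finite_orbits_fibre` — (hfib) with `π p := (absIntegersCentre p.1).under (𝓞 K)` every
  fibre is ONE orbit;
* `isOpen_stabilizer_root`, `stabilizer_primitiveRoot_normal` — (hV₀) `Stab_Γ(ζ)` is open and normal;
  `mu_apply_eq_self_of_le_stabilizer` — `W ≤ Stab_Γ(ζ)` acts trivially on `μ_ℓ(K̄)`;
* `axLn_of_le_stabilizer`, `axD_of_le_stabilizer`, `axLv_of_le_stabilizer`, `axLi_of_le_stabilizer` —
  the D-side local-type axioms of `NeukirchLocalAxiomsNF.lean` RESTATED with the abstract theorem's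
  binder `W ≤ V₀ = Stab_Γ(ζ)` in place of the `μ_ℓ`-hypothesis (for `p : NonArch K` read
  `Stab_Γ(p) = Stab_Γ(p.1)` by `Subtype.ext`; no instance is declared here).

HONEST FRAMING: classical; nothing here bears on [IUTchIII] Cor. 3.12; no side taken.

## References

* J. Neukirch, A. Schmidt, K. Wingberg, *Cohomology of Number Fields* (2nd ed. 2008), XII §1
  Prop. (12.1.9). [NeukirchSchmidtWingberg2008]
* J. Neukirch, *Algebraic Number Theory* (1999), Ch. I §9 (9.1), Ch. II §8–9. [NeukirchANT1999]
-/

noncomputable section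

open scoped NumberField Pointwise
open Field IsDedekindDomain Function Topology

namespace Literature.NumberTheory.GaloisRepresentations.ExplicitMuCocycles

open Literature.NumberTheory.GaloisRepresentations
open Literature.AnabelianGeometry.AbsoluteAnabelian (decompositionGroupNF decompositionGroupNF_eq_stabilizer
  isClosed_decompositionGroupNF)
open DiscreteGaloisModule

variable (K : Type) [Field K] [NumberField K]

/-! ### Stabilisers of nonarchimedean primes -/

omit [NumberField K] in
/-- **(hst) decomposition groups are closed**: `Stab_Γ(A) = decompositionGroupNF K A` is closed in the
Krull topology (`isClosed_decompositionGroupNF`, abc-iut-L4-d2). For the subtype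
`P := NumberFieldValuationProSet.NonArch K` with `nonArchAction`, `Stab_Γ(p) = Stab_Γ(p.1)` by
`Subtype.ext`. [cite: NeukirchSchmidtWingberg2008, XII §1 (12.1.9)] -/
theorem isClosed_stabilizer_valuationSubring (A : ValuationSubring (AlgebraicClosure K)) :
    IsClosed (MulAction.stabilizer (absoluteGaloisGroup K) A : Set (absoluteGaloisGroup K)) := by
  rw [← decompositionGroupNF_eq_stabilizer]
  exact isClosed_decompositionGroupNF K A

/-! ### Fibres of `A ↦ (𝔪_A ∩ \bar ℤ_K) ∩ 𝓞 K` are orbits -/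

/-- **Transitivity on valuation subrings.**  Two nontrivial valuation subrings of `K̄` whose centres
on `\bar ℤ_K` lie over the same prime of `𝓞 K` are conjugate under `Γ_K` (Neukirch *ANT* I (9.1),
for the profinite `Γ_K` acting on the discrete ring `\bar ℤ_K`; centres ↔ valuation rings by
`eq_absIntegersValuationSubring_of_absIntegersCentre_eq`). [cite: NeukirchANT1999, Ch. I §9 Prop. (9.1)] -/
theorem exists_smul_eq_of_under_absIntegersCentre_eq {A B : ValuationSubring (AlgebraicClosure K)}
    (hB : B ≠ ⊤)
    (h : (absIntegersCentre A).under (𝓞 K) = (absIntegersCentre B).under (𝓞 K)) :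
    ∃ σ : absoluteGaloisGroup K, σ • A = B := by
  classical
  letI : TopologicalSpace (absIntegers (𝓞 K) K) := ⊥
  haveI : DiscreteTopology (absIntegers (𝓞 K) K) := ⟨rfl⟩
  haveI := absIntegers.continuousSMul (𝓞 K) (K := K)
  haveI := absIntegers.isInvariant (𝓞 K) (K := K)
  haveI := absIntegersCentre_isPrime A
  haveI := absIntegersCentre_isPrime B
  obtain ⟨σ, hσ⟩ := Algebra.IsInvariant.exists_smul_of_under_eq_of_profinite
    (A := 𝓞 K) (G := absoluteGaloisGroup K) (absIntegersCentre A) (absIntegersCentre B) h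
  refine ⟨σ, ?_⟩
  haveI := absIntegersCentre_isMaximal B hB
  have hσ' : absIntegersCentre (σ • A) = absIntegersCentre B := by
    rw [absIntegersCentre_smul, ← hσ]
  rw [eq_absIntegersValuationSubring_of_absIntegersCentre_eq _ (absIntegersCentre B) hσ',
    ← eq_absIntegersValuationSubring_of_absIntegersCentre_eq B (absIntegersCentre B) rfl]

/-- **(hfib) every fibre of `π : A ↦ (centre of A) ∩ 𝓞 K` is a single `Γ_K`-orbit**, in the finite
form the abstract lemma asks for, on the plain subtype `{A // A ≠ ⊤}` (= `NumberFieldValuationProSet.NonArch K`;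
the assembler reads `g • q.1 = p.1` as `g • q = p` for `nonArchAction`). [cite: NeukirchSchmidtWingberg2008, XII §1 (12.1.9)] -/
theorem finite_orbits_fibre (i : Ideal (𝓞 K)) :
    ∃ s : Finset {A : ValuationSubring (AlgebraicClosure K) // A ≠ ⊤},
      ∀ p : {A : ValuationSubring (AlgebraicClosure K) // A ≠ ⊤},
        (absIntegersCentre p.1).under (𝓞 K) = i →
          ∃ q ∈ s, ∃ g : absoluteGaloisGroup K, g • q.1 = p.1 := by
  classical
  by_cases h : ∃ q : {A : ValuationSubring (AlgebraicClosure K) // A ≠ ⊤},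
      (absIntegersCentre q.1).under (𝓞 K) = i
  · obtain ⟨q, hq⟩ := h
    refine ⟨{q}, fun p hp => ⟨q, Finset.mem_singleton_self q, ?_⟩⟩
    exact exists_smul_eq_of_under_absIntegersCentre_eq K p.2 (hq.trans hp.symm)
  · exact ⟨∅, fun p hp => absurd ⟨p, hp⟩ h⟩

/-! ### `V₀ := Stab_Γ(ζ)` -/

omit [NumberField K] in
/-- The stabiliser of an element of `K̄` is open (Krull topology). [cite: NeukirchANT1999, Ch. IV §1] -/
theorem isOpen_stabilizer_root (x : AlgebraicClosure K) :
    IsOpen (MulAction.stabilizer (absoluteGaloisGroup K) x : Set (absoluteGaloisGroup K)) :=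
  Subgroup.isOpen_of_mem_nhds _ (setOf_smul_eq_mem_nhds_one K x)

omit [NumberField K] in
/-- **`Stab_Γ(ζ) = Gal(K̄/K(ζ))` is normal** for a primitive `ℓ`-th root of unity `ζ`: every `g ∈ Γ_K`
maps `ζ` to a power of `ζ`. [cite: NeukirchANT1999, Ch. IV §1] -/
theorem stabilizer_primitiveRoot_normal {ℓ : ℕ} (hℓ : ℓ.Prime) {ζ : AlgebraicClosure K}
    (hζ : IsPrimitiveRoot ζ ℓ) : (MulAction.stabilizer (absoluteGaloisGroup K) ζ).Normal := by
  haveI : NeZero ℓ := ⟨hℓ.ne_zero⟩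
  refine ⟨fun σ hσ g => ?_⟩
  rw [MulAction.mem_stabilizer_iff] at hσ ⊢
  -- `g⁻¹ • ζ` is an `ℓ`-th root of unity, hence a power of `ζ`, hence fixed by `σ`
  have hpow : (g⁻¹ • ζ) ^ ℓ = 1 := by rw [← smul_pow', hζ.pow_eq_one, smul_one]
  obtain ⟨i, -, hi⟩ := hζ.eq_pow_of_pow_eq_one hpow
  have hσi : σ • (g⁻¹ • ζ) = g⁻¹ • ζ := by rw [← hi, smul_pow', hσ]
  rw [mul_smul, mul_smul, hσi, smul_inv_smul]

omit [NumberField K] in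
/-- **`W ≤ Stab_Γ(ζ)` acts trivially on `μ_ℓ(K̄)`** (`ζ` a primitive `ℓ`-th root of unity): every
`ℓ`-th root of unity is a power of `ζ`. [cite: NeukirchSchmidtWingberg2008, XII §1 (12.1.9)] -/
theorem mu_apply_eq_self_of_le_stabilizer {ℓ : ℕ} [hℓ : Fact ℓ.Prime] {ζ : AlgebraicClosure K}
    (hζ : IsPrimitiveRoot ζ ℓ) {W : Subgroup (absoluteGaloisGroup K)}
    (hW : W ≤ MulAction.stabilizer (absoluteGaloisGroup K) ζ) :
    ∀ σ ∈ W, ∀ z : MuCarrier K ℓ, mu K ℓ σ z = z := by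
  intro σ hσ
  apply mu_apply_eq_self_of_forall_smul_eq_self
  intro x hx
  obtain ⟨i, -, hi⟩ := hζ.eq_pow_of_pow_eq_one hx
  have hσζ : σ • ζ = ζ := MulAction.mem_stabilizer_iff.mp (hW hσ)
  rw [← hi, smul_pow', hσζ]

/-! ### The D-side axioms in the abstract lemma's binder form -/

section DSide

variable {K}
variable {ℓ : ℕ} [hℓ : Fact ℓ.Prime] {ζ : AlgebraicClosure K} (hζ : IsPrimitiveRoot ζ ℓ)

include hζ

/-- **(AxLn)** binder of `exists_prime_smul_eq_of_localType` at `Γ_K`: for `A ≠ ⊤` and an open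
`W ≤ Stab_Γ(ζ)`, `H²(Stab(A) ∩ W, ℤ/ℓ) ≠ 0` explicitly (`axLn_stabilizer_inf`).
[cite: NeukirchSchmidtWingberg2008, XII §1 (12.1.9)] -/
theorem axLn_of_le_stabilizer (A : ValuationSubring (AlgebraicClosure K)) (hA : A ≠ ⊤) (W : Subgroup (absoluteGaloisGroup K))
    (hW : IsOpen (W : Set (absoluteGaloisGroup K)))
    (hWV : W ≤ MulAction.stabilizer (absoluteGaloisGroup K) ζ) :
    ∃ f : absoluteGaloisGroup K → absoluteGaloisGroup K → ZMod ℓ,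
      IsLocallyConstant
          (fun q : ↥(MulAction.stabilizer (absoluteGaloisGroup K) A ⊓ W) ×
            ↥(MulAction.stabilizer (absoluteGaloisGroup K) A ⊓ W) => f q.1 q.2) ∧
      (∀ a ∈ MulAction.stabilizer (absoluteGaloisGroup K) A ⊓ W,
        ∀ b ∈ MulAction.stabilizer (absoluteGaloisGroup K) A ⊓ W,
        ∀ c ∈ MulAction.stabilizer (absoluteGaloisGroup K) A ⊓ W,
          f a b + f (a * b) c = f b c + f a (b * c)) ∧
      ¬ ∃ β : absoluteGaloisGroup K → ZMod ℓ,
        IsLocallyConstant (fun s : ↥(MulAction.stabilizer (absoluteGaloisGroup K) A ⊓ W) => β s) ∧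
          ∀ a ∈ MulAction.stabilizer (absoluteGaloisGroup K) A ⊓ W,
            ∀ b ∈ MulAction.stabilizer (absoluteGaloisGroup K) A ⊓ W,
              f a b = β a + β b - β (a * b) := by
  exact axLn_stabilizer_inf K A hA W hW (mu_apply_eq_self_of_le_stabilizer K hζ hWV)

/-- **(AxD)** binder at `Γ_K`: `dim H²(Stab(A) ∩ W, ℤ/ℓ) ≤ 1` explicitly (`axD_stabilizer_inf`).
[cite: NeukirchSchmidtWingberg2008, XII §1 (12.1.9)] -/
theorem axD_of_le_stabilizer (A : ValuationSubring (AlgebraicClosure K)) (hA : A ≠ ⊤) (W : Subgroup (absoluteGaloisGroup K))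
    (hW : IsOpen (W : Set (absoluteGaloisGroup K)))
    (hWV : W ≤ MulAction.stabilizer (absoluteGaloisGroup K) ζ)
    (f g : absoluteGaloisGroup K → absoluteGaloisGroup K → ZMod ℓ)
    (hflc : IsLocallyConstant
      (fun q : ↥(MulAction.stabilizer (absoluteGaloisGroup K) A ⊓ W) ×
        ↥(MulAction.stabilizer (absoluteGaloisGroup K) A ⊓ W) => f q.1 q.2))
    (hfcoc : ∀ a ∈ MulAction.stabilizer (absoluteGaloisGroup K) A ⊓ W,
      ∀ b ∈ MulAction.stabilizer (absoluteGaloisGroup K) A ⊓ W,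
      ∀ c ∈ MulAction.stabilizer (absoluteGaloisGroup K) A ⊓ W,
        f a b + f (a * b) c = f b c + f a (b * c))
    (hglc : IsLocallyConstant
      (fun q : ↥(MulAction.stabilizer (absoluteGaloisGroup K) A ⊓ W) ×
        ↥(MulAction.stabilizer (absoluteGaloisGroup K) A ⊓ W) => g q.1 q.2))
    (hgcoc : ∀ a ∈ MulAction.stabilizer (absoluteGaloisGroup K) A ⊓ W,
      ∀ b ∈ MulAction.stabilizer (absoluteGaloisGroup K) A ⊓ W,
      ∀ c ∈ MulAction.stabilizer (absoluteGaloisGroup K) A ⊓ W,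
        g a b + g (a * b) c = g b c + g a (b * c))
    (hf : ¬ ∃ β : absoluteGaloisGroup K → ZMod ℓ,
      IsLocallyConstant (fun s : ↥(MulAction.stabilizer (absoluteGaloisGroup K) A ⊓ W) => β s) ∧
        ∀ a ∈ MulAction.stabilizer (absoluteGaloisGroup K) A ⊓ W,
          ∀ b ∈ MulAction.stabilizer (absoluteGaloisGroup K) A ⊓ W, f a b = β a + β b - β (a * b)) :
    ∃ c : ZMod ℓ, ∃ β : absoluteGaloisGroup K → ZMod ℓ,
      IsLocallyConstant (fun s : ↥(MulAction.stabilizer (absoluteGaloisGroup K) A ⊓ W) => β s) ∧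
        ∀ a ∈ MulAction.stabilizer (absoluteGaloisGroup K) A ⊓ W,
          ∀ b ∈ MulAction.stabilizer (absoluteGaloisGroup K) A ⊓ W,
            (g a b - c * f a b) = β a + β b - β (a * b) := by
  exact axD_stabilizer_inf K A hA W hW (mu_apply_eq_self_of_le_stabilizer K hζ hWV)
    f g hflc hfcoc hglc hgcoc hf

/-- **(AxLv)** binder at `Γ_K`: restriction to `Stab(A) ∩ W'` kills `H²(Stab(A) ∩ W)` when
`ℓ ∣ [Stab(A) ∩ W : Stab(A) ∩ W']` (`axLv_stabilizer_inf`). [cite: NeukirchSchmidtWingberg2008, XII §1 (12.1.9)] -/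
theorem axLv_of_le_stabilizer (A : ValuationSubring (AlgebraicClosure K)) (hA : A ≠ ⊤) (W W' : Subgroup (absoluteGaloisGroup K))
    (hW : IsOpen (W : Set (absoluteGaloisGroup K))) (hW' : IsOpen (W' : Set (absoluteGaloisGroup K)))
    (hWV : W ≤ MulAction.stabilizer (absoluteGaloisGroup K) ζ) (hW'W : W' ≤ W)
    (hdvd : ℓ ∣ (MulAction.stabilizer (absoluteGaloisGroup K) A ⊓ W').relIndex
      (MulAction.stabilizer (absoluteGaloisGroup K) A ⊓ W))
    (f : absoluteGaloisGroup K → absoluteGaloisGroup K → ZMod ℓ)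
    (hflc : IsLocallyConstant
      (fun q : ↥(MulAction.stabilizer (absoluteGaloisGroup K) A ⊓ W) ×
        ↥(MulAction.stabilizer (absoluteGaloisGroup K) A ⊓ W) => f q.1 q.2))
    (hfcoc : ∀ a ∈ MulAction.stabilizer (absoluteGaloisGroup K) A ⊓ W,
      ∀ b ∈ MulAction.stabilizer (absoluteGaloisGroup K) A ⊓ W,
      ∀ c ∈ MulAction.stabilizer (absoluteGaloisGroup K) A ⊓ W,
        f a b + f (a * b) c = f b c + f a (b * c)) :
    ∃ β : absoluteGaloisGroup K → ZMod ℓ,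
      IsLocallyConstant (fun s : ↥(MulAction.stabilizer (absoluteGaloisGroup K) A ⊓ W') => β s) ∧
        ∀ a ∈ MulAction.stabilizer (absoluteGaloisGroup K) A ⊓ W',
          ∀ b ∈ MulAction.stabilizer (absoluteGaloisGroup K) A ⊓ W', f a b = β a + β b - β (a * b) := by
  exact axLv_stabilizer_inf K A hA W W' hW hW' (mu_apply_eq_self_of_le_stabilizer K hζ hWV) hW'W
    hdvd f hflc hfcoc

/-- **(AxLi)** binder at `Γ_K`: restriction to `Stab(A) ∩ W'` is injective on `H²(Stab(A) ∩ W)` when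
`ℓ ∤ [Stab(A) ∩ W : Stab(A) ∩ W']` (`axLi_stabilizer_inf`). [cite: NeukirchSchmidtWingberg2008, XII §1 (12.1.9)] -/
theorem axLi_of_le_stabilizer (A : ValuationSubring (AlgebraicClosure K)) (hA : A ≠ ⊤) (W W' : Subgroup (absoluteGaloisGroup K))
    (hW : IsOpen (W : Set (absoluteGaloisGroup K))) (hW' : IsOpen (W' : Set (absoluteGaloisGroup K)))
    (hWV : W ≤ MulAction.stabilizer (absoluteGaloisGroup K) ζ) (hW'W : W' ≤ W)
    (hnd : ¬ ℓ ∣ (MulAction.stabilizer (absoluteGaloisGroup K) A ⊓ W').relIndex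
      (MulAction.stabilizer (absoluteGaloisGroup K) A ⊓ W))
    (f : absoluteGaloisGroup K → absoluteGaloisGroup K → ZMod ℓ)
    (hflc : IsLocallyConstant
      (fun q : ↥(MulAction.stabilizer (absoluteGaloisGroup K) A ⊓ W) ×
        ↥(MulAction.stabilizer (absoluteGaloisGroup K) A ⊓ W) => f q.1 q.2))
    (hfcoc : ∀ a ∈ MulAction.stabilizer (absoluteGaloisGroup K) A ⊓ W,
      ∀ b ∈ MulAction.stabilizer (absoluteGaloisGroup K) A ⊓ W,
      ∀ c ∈ MulAction.stabilizer (absoluteGaloisGroup K) A ⊓ W,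
        f a b + f (a * b) c = f b c + f a (b * c))
    (hcob : ∃ β : absoluteGaloisGroup K → ZMod ℓ,
      IsLocallyConstant (fun s : ↥(MulAction.stabilizer (absoluteGaloisGroup K) A ⊓ W') => β s) ∧
        ∀ a ∈ MulAction.stabilizer (absoluteGaloisGroup K) A ⊓ W',
          ∀ b ∈ MulAction.stabilizer (absoluteGaloisGroup K) A ⊓ W', f a b = β a + β b - β (a * b)) :
    ∃ β : absoluteGaloisGroup K → ZMod ℓ,
      IsLocallyConstant (fun s : ↥(MulAction.stabilizer (absoluteGaloisGroup K) A ⊓ W) => β s) ∧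
        ∀ a ∈ MulAction.stabilizer (absoluteGaloisGroup K) A ⊓ W,
          ∀ b ∈ MulAction.stabilizer (absoluteGaloisGroup K) A ⊓ W, f a b = β a + β b - β (a * b) := by
  exact axLi_stabilizer_inf K A hA W W' hW hW' (mu_apply_eq_self_of_le_stabilizer K hζ hWV) hW'W
    hnd f hflc hfcoc hcob

end DSide

end Literature.NumberTheory.GaloisRepresentations.ExplicitMuCocycles

end
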